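import Summits.Ventures.WeilGRH.UniformConductorFloorLorentz
import HarnessLib

/-!
# GRH arm (rh-explicit, venture WeilGRH): the ALL-TRIVIAL KEY is a universal minorant of the twisted Weil form

Cell `rh-explicit`, WEIL TRACK — GRH ARM (weil-grh-1; statement and proof sketch also in weil-grh-2's MINORANT.md).
For a Dirichlet character `χ` mod `q ≠ 1` of parity `κ` (`x = ¼ + κ/2`), a window `t` (`e^{2t} ≤ N + 1`) and a test function
`g` supported in `[-t, t]`, write `h = |g|` and `c_h(u) = ∫ h(y) h(y − u) dy` (so `c_h(0) = ‖g‖₂²`, `0 ≤ c_h(u) ≤ c_h(0)`).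
The **all-trivial-key form** of parity parameter `x`, conductor parameter `q` and `M` Lévy layers is (position space)

  `T_M(h) = (log q − log π + ψ(x)) c_h(0) + Σ_{m<M} ∫ e^{−2(m+x)|u|} (c_h(0) − c_h(u)) du − Σ_{n≤N} (Λ(n)/√n)·2 c_h(log n)`

(`trivialKeyFormTrunc`): Weil's twisted form with EVERY character value replaced by `1` (also at the primes dividing `q`)
and the archimedean weight `Re ψ(x + iτ/2)` replaced by its first `M` vertical-series layers, evaluated at the real
function `h`.  **THEOREM (`re_weilQuadraticChar_ge_trivialKeyFormTrunc`): `T_M(|g|) ≤ Re Q_χ(g)` for every `M`.**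
Both halves are the triangle inequality against positive weights: on the prime side
`|Re χ(n) k_g(log n)| ≤ |k_g(log n)| ≤ c_{|g|}(log n)`; on the archimedean side each layer is, by
`lorentz_deficit_eq_integral`, `(1/2π)∫|ĝ|² [1/l − l/(l² + τ²/4)] dτ = ∫ e^{−2l|u|}(‖g‖² − Re k_g(u)) du ≥ ∫ e^{−2l|u|}(c_h(0) − c_h(u)) du`.
Consequence (`weilPositivityOnChar_of_trivialKeyFormTrunc_nonneg`): **if `T_M ≥ 0` at `|g|` for every test `g` on the
window, at conductor parameter `Q₀`, then `WeilPositivityOnChar χ t` for EVERY character of parity `κ` and EVERY modulus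
`q ≥ Q₀`** — the uniform-in-`χ` floor of the rung `t` is the floor of ONE explicit real quadratic form (the cell's
certificates: `Q₀ = 75` / odd `30` at `t = 1`, exact; `UniformConductorFloor*.lean` prove `168` / `60` certificate-free).
The layers increase with `M`; the full Lévy density `Σ_m e^{−2(m+x)|u|} = e^{−2x|u|}/(1 − e^{−2|u|})` is Weil's kernel
`e^{(½−κ)|u|}/(2 sinh|u|)` of (11) (`levyDensity`; the `M = ∞` form is `UniformConductorFloorMinorantLimit.lean`).

## References

* A. Weil (1952), (11) with (5), (10) and the «lemme» p. 262 [Weil1952FormulesExplicites];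
  H. L. Montgomery, R. C. Vaughan (2007), (12.22), Lemma 12.14 (position form of the archimedean term) [MontgomeryVaughan2007];
  A. Beurling, J. Deny (1958), the first criterion (contractions lower Dirichlet forms). [folklore]
-/

noncomputable section

open Complex Filter Set MeasureTheory
open scoped Real Topology ComplexConjugate ArithmeticFunction.vonMangoldt

namespace Summit.Ventures.WeilGRH

open Literature.NumberTheory.LFunctions

namespace UniformFloor

variable {g : ℝ → ℂ}

/-! ## Definitions -/

/-- The **Lévy density of the archimedean term** of parity parameter `x` (`= ¼ + a/2`):
`J_x(u) = e^{−2x|u|}/(1 − e^{−2|u|}) = Σ_{m ≥ 0} e^{−2(m+x)|u|}` (`u ≠ 0`; junk value `0` at `u = 0`) — Weil's kernel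
`e^{(½−a)|u|}/|e^{u} − e^{−u}|` of (11). [cite: Weil1952FormulesExplicites, (11) p. 261 (the kernel K_{1,a})] -/
def levyDensity (x u : ℝ) : ℝ := Real.exp (-(2 * x * |u|)) / (1 - Real.exp (-(2 * |u|)))

/-- The **all-trivial-key form with `M` Lévy layers**, `T_M(h)` of the module docstring, for a real function `h`
(parity parameter `x`, conductor parameter `q`, prime powers `n ≤ N`).
[cite: Weil1952FormulesExplicites, (11) pp. 261–262 with every χ(n) replaced by 1] -/
def trivialKeyFormTrunc (x : ℝ) (q N M : ℕ) (h : ℝ → ℝ) : ℝ :=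
  (Real.log q - Real.log π + (digamma (x : ℂ)).re) * (∫ y : ℝ, h y ^ 2) +
    (∑ m ∈ Finset.range M, ∫ u : ℝ, Real.exp (-(2 * ((m : ℝ) + x) * |u|)) *
      ((∫ y : ℝ, h y ^ 2) - ∫ y : ℝ, h y * h (y - u))) -
    ∑ n ∈ Finset.range (N + 1), (Λ n : ℝ) / Real.sqrt n * (2 * ∫ y : ℝ, h y * h (y - Real.log n))

/-! ## The autocorrelation of `|g|` -/

/-- `∫ |g(y)| |g(y − u)| dy ≤ ‖g‖₂²` (`2ab ≤ a² + b²` and translation invariance). [folklore] -/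
theorem integral_norm_mul_norm_shift_le (hg : IsWeilTest g) (u : ℝ) :
    ∫ y : ℝ, ‖g y‖ * ‖g (y - u)‖ ≤ weilNorm2Sq g := by
  have hgc : Continuous g := hg.1.continuous
  have hI3 : Integrable (fun y : ℝ ↦ ‖g y‖ ^ 2) := by
    refine (hgc.norm.pow 2).integrable_of_hasCompactSupport ?_
    rw [pow_two]; exact hg.2.norm.mul_right
  have hI4 : Integrable (fun y : ℝ ↦ ‖g (y - u)‖ ^ 2) := hI3.comp_sub_right u
  have hI1 : Integrable (fun y : ℝ ↦ ‖g y‖ * ‖g (y - u)‖) :=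
    (hgc.norm.mul (hgc.comp (continuous_id.sub continuous_const)).norm).integrable_of_hasCompactSupport
      hg.2.norm.mul_right
  calc ∫ y : ℝ, ‖g y‖ * ‖g (y - u)‖ ≤ ∫ y : ℝ, (‖g y‖ ^ 2 + ‖g (y - u)‖ ^ 2) / 2 :=
        integral_mono hI1 ((hI3.add hI4).div_const 2) fun y ↦ by
          have := two_mul_le_add_sq ‖g y‖ ‖g (y - u)‖
          simp only
          linarith
    _ = ((∫ y : ℝ, ‖g y‖ ^ 2) + ∫ y : ℝ, ‖g (y - u)‖ ^ 2) / 2 := by rw [integral_div, integral_add hI3 hI4]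
    _ = weilNorm2Sq g := by
        rw [integral_sub_right_eq_self (fun y : ℝ ↦ ‖g y‖ ^ 2) u, weilNorm2Sq]; ring

/-- `0 ≤ ∫ |g(y)| |g(y − u)| dy`. [folklore] -/
theorem integral_norm_mul_norm_shift_nonneg (g : ℝ → ℂ) (u : ℝ) : 0 ≤ ∫ y : ℝ, ‖g y‖ * ‖g (y - u)‖ :=
  integral_nonneg fun _ ↦ by positivity

/-- `u ↦ ∫ |g(y)||g(y − u)| dy` is (strongly) measurable (a parametric integral of a jointly continuous
integrand). [folklore] -/
theorem stronglyMeasurable_integral_norm_mul_norm_shift (hg : IsWeilTest g) :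
    StronglyMeasurable fun u : ℝ ↦ ∫ y : ℝ, ‖g y‖ * ‖g (y - u)‖ := by
  have hgc : Continuous g := hg.1.continuous
  have hc : Continuous (Function.uncurry fun u y : ℝ ↦ ‖g y‖ * ‖g (y - u)‖) :=
    ((hgc.comp continuous_snd).norm).mul ((hgc.comp (continuous_snd.sub continuous_fst)).norm)
  exact hc.stronglyMeasurable.integral_prod_right

/-! ## One Lévy layer -/

/-- `∫ e^{−a|u|} du = 2/a` (`a > 0`). [folklore] -/
theorem integral_exp_neg_mul_abs' {a : ℝ} (ha : 0 < a) : ∫ u : ℝ, Real.exp (-(a * |u|)) = 2 / a := by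
  have h := integral_exp_neg_mul_abs_mul_cos ha 0
  simp only [zero_mul, Real.cos_zero, mul_one] at h
  rw [h]
  have ha0 : a ≠ 0 := ha.ne'
  field_simp
  ring

/-- **One layer of the archimedean term in position space**: for a test function `g`, `k = g ⋆ g̃`, `l > 0`:
`(1/2π)∫|ĝ(1/2+iτ)|² [1/l − l/(l² + τ²/4)] dτ = ∫ e^{−2l|u|} (‖g‖₂² − Re k(u)) du`. [folklore] -/
theorem layer_eq_integral (hg : IsWeilTest g) {l : ℝ} (hl : 0 < l) :
    1 / (2 * π) * ∫ τ : ℝ, ‖weilMellin g (1 / 2 + τ * I)‖ ^ 2 * (1 / l - l / (l ^ 2 + (τ / 2) ^ 2)) =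
      ∫ u : ℝ, Real.exp (-(2 * l * |u|)) * (weilNorm2Sq g - (weilConv g (weilReflect g) u).re) := by
  have hIW : Integrable fun τ : ℝ ↦ ‖weilMellin g (1 / 2 + τ * I)‖ ^ 2 := integrable_norm_sq_weilMellin_half_line hg
  have hIL : Integrable fun τ : ℝ ↦ ‖weilMellin g (1 / 2 + τ * I)‖ ^ 2 * (l / (l ^ 2 + (τ / 2) ^ 2)) :=
    integrable_norm_sq_weilMellin_mul hg (continuous_lorentz hl).measurable (A := 1 / l) (B := 0)
      (by positivity) le_rfl fun τ ↦ by
        rw [abs_of_nonneg (lorentz_nonneg hl τ), zero_mul, add_zero]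
        exact lorentz_le hl τ
  have hE : Integrable fun u : ℝ ↦ Real.exp (-(2 * l * |u|)) := integrable_exp_neg_mul_abs (by positivity)
  have hEk : Integrable fun u : ℝ ↦ Real.exp (-(2 * l * |u|)) * (weilConv g (weilReflect g) u).re := by
    refine (hE.mul_const (weilNorm2Sq g)).mono' ?_ (Eventually.of_forall fun u ↦ ?_)
    · exact ((Real.continuous_exp.comp ((continuous_const.mul continuous_abs).neg)).mul
        (Complex.continuous_re.comp (hg.weilConv hg.weilReflect).1.continuous)).aestronglyMeasurable
    · rw [norm_mul, Real.norm_of_nonneg (Real.exp_pos _).le]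
      exact mul_le_mul_of_nonneg_left ((Complex.abs_re_le_norm _).trans (norm_weilConv_weilReflect_le hg u))
        (Real.exp_pos _).le
  have e1 : ∫ τ : ℝ, ‖weilMellin g (1 / 2 + τ * I)‖ ^ 2 * (1 / l - l / (l ^ 2 + (τ / 2) ^ 2)) =
      (∫ τ : ℝ, ‖weilMellin g (1 / 2 + τ * I)‖ ^ 2 * (1 / l)) -
        ∫ τ : ℝ, ‖weilMellin g (1 / 2 + τ * I)‖ ^ 2 * (l / (l ^ 2 + (τ / 2) ^ 2)) := by
    rw [← integral_sub (hIW.mul_const _) hIL]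
    refine integral_congr_ae (Eventually.of_forall fun τ ↦ ?_)
    simp only; ring
  rw [e1, integral_mul_const, integral_norm_sq_weilMellin_half_line hg, lorentz_deficit_eq_integral hg hl]
  have e2 : ∫ u : ℝ, Real.exp (-(2 * l * |u|)) * (weilNorm2Sq g - (weilConv g (weilReflect g) u).re) =
      (∫ u : ℝ, Real.exp (-(2 * l * |u|))) * weilNorm2Sq g -
        ∫ u : ℝ, Real.exp (-(2 * l * |u|)) * (weilConv g (weilReflect g) u).re := by
    rw [← integral_mul_const, ← integral_sub (hE.mul_const _) hEk]
    refine integral_congr_ae (Eventually.of_forall fun u ↦ ?_)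
    simp only; ring
  rw [e2, integral_exp_neg_mul_abs' (by positivity : 0 < 2 * l)]
  have hπ : (π : ℝ) ≠ 0 := Real.pi_ne_zero
  have hl0 : l ≠ 0 := hl.ne'
  field_simp

/-- **Domination of one layer by the autocorrelation of `|g|`**: `‖g‖₂² − Re k_g(u) ≥ ‖g‖₂² − ∫|g(y)||g(y−u)|dy ≥ 0`,
hence `∫ e^{−2l|u|}(‖g‖₂² − Re k(u)) du ≥ ∫ e^{−2l|u|}(‖g‖₂² − ∫|g(y)||g(y−u)|dy) du`. [folklore] -/
theorem layer_ge_abs (hg : IsWeilTest g) {l : ℝ} (hl : 0 < l) :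
    ∫ u : ℝ, Real.exp (-(2 * l * |u|)) * (weilNorm2Sq g - ∫ y : ℝ, ‖g y‖ * ‖g (y - u)‖) ≤
      ∫ u : ℝ, Real.exp (-(2 * l * |u|)) * (weilNorm2Sq g - (weilConv g (weilReflect g) u).re) := by
  have hE : Integrable fun u : ℝ ↦ Real.exp (-(2 * l * |u|)) := integrable_exp_neg_mul_abs (by positivity)
  have hEc : Continuous fun u : ℝ ↦ Real.exp (-(2 * l * |u|)) :=
    Real.continuous_exp.comp ((continuous_const.mul continuous_abs).neg)
  have hb : ∀ u, |weilNorm2Sq g - ∫ y : ℝ, ‖g y‖ * ‖g (y - u)‖| ≤ weilNorm2Sq g := fun u ↦ by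
    rw [abs_of_nonneg (sub_nonneg.2 (integral_norm_mul_norm_shift_le hg u))]
    linarith [integral_norm_mul_norm_shift_nonneg g u]
  have hI1 : Integrable fun u : ℝ ↦ Real.exp (-(2 * l * |u|)) * (weilNorm2Sq g - ∫ y : ℝ, ‖g y‖ * ‖g (y - u)‖) := by
    refine (hE.mul_const (weilNorm2Sq g)).mono' ?_ (Eventually.of_forall fun u ↦ ?_)
    · exact (hEc.measurable.mul (measurable_const.sub
        (stronglyMeasurable_integral_norm_mul_norm_shift hg).measurable)).aestronglyMeasurable
    · rw [norm_mul, Real.norm_of_nonneg (Real.exp_pos _).le, Real.norm_eq_abs]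
      exact mul_le_mul_of_nonneg_left (hb u) (Real.exp_pos _).le
  have hI2 : Integrable fun u : ℝ ↦ Real.exp (-(2 * l * |u|)) * (weilNorm2Sq g - (weilConv g (weilReflect g) u).re) := by
    refine (hE.mul_const (2 * weilNorm2Sq g)).mono' ?_ (Eventually.of_forall fun u ↦ ?_)
    · exact (hEc.mul (continuous_const.sub
        (Complex.continuous_re.comp (hg.weilConv hg.weilReflect).1.continuous))).aestronglyMeasurable
    · rw [norm_mul, Real.norm_of_nonneg (Real.exp_pos _).le, Real.norm_eq_abs]
      refine mul_le_mul_of_nonneg_left ?_ (Real.exp_pos _).le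
      have h1 := (Complex.abs_re_le_norm _).trans (norm_weilConv_weilReflect_le hg u)
      have hNN : (∫ t : ℝ, ‖g t‖ ^ 2) = weilNorm2Sq g := rfl
      rw [hNN] at h1
      have h0 : 0 ≤ weilNorm2Sq g := integral_nonneg fun _ ↦ by positivity
      rw [abs_le] at h1 ⊢
      constructor <;> nlinarith [h1.1, h1.2]
  refine integral_mono hI1 hI2 fun u ↦ mul_le_mul_of_nonneg_left ?_ (Real.exp_pos _).le
  have : (weilConv g (weilReflect g) u).re ≤ ∫ y : ℝ, ‖g y‖ * ‖g (y - u)‖ :=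
    (Complex.re_le_norm _).trans (norm_weilConv_weilReflect_le_integral_mul g u)
  simp only
  linarith

/-! ## The minorant theorem with `M` layers -/

/-- **THE ALL-TRIVIAL KEY MINORISES EVERY CHARACTER** (`M` Lévy layers).  For `χ` mod `q ≠ 1` of parity `κ`,
`x = ¼ + κ/2`, a test function `g` supported in `[-t, t]` and `e^{2t} ≤ N + 1`:
`T_M(|g|) ≤ Re Q_χ(g)` for every `M`, where `T_M = trivialKeyFormTrunc x q N M` is Weil's twisted form with every
character value replaced by `1` and `M` layers of the archimedean Lévy density, evaluated at `|g|`.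
[cite: Weil1952FormulesExplicites, (11) pp. 261–262 and the «lemme» p. 262] -/
theorem re_weilQuadraticChar_ge_trivialKeyFormTrunc {q : ℕ} (hq : q ≠ 1) (χ : DirichletCharacter ℂ q) {κ : ℕ}
    (hκ : charParity χ = κ) (hg : IsWeilTest g) {t : ℝ} (hsupp : tsupport g ⊆ Icc (-t) t) {N : ℕ}
    (hN : Real.exp (2 * t) ≤ (N : ℝ) + 1) (M : ℕ) :
    trivialKeyFormTrunc (1 / 4 + (κ : ℝ) / 2) q N M (fun y ↦ ‖g y‖) ≤ (weilQuadraticChar χ g).re := by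
  set k := weilConv g (weilReflect g) with hk
  set N2 := weilNorm2Sq g with hN2
  set x : ℝ := 1 / 4 + (κ : ℝ) / 2 with hx
  have hx0 : 0 < x := by positivity
  set W : ℝ → ℝ := fun τ ↦ ‖weilMellin g (1 / 2 + τ * I)‖ ^ 2 with hW
  set A : ℝ := ∫ τ : ℝ, W τ * (digamma ((x : ℂ) + ((τ / 2 : ℝ) : ℂ) * I)).re with hA
  have hre : (weilQuadraticChar χ g).re = -(weilPrimeTermChar χ k).re + (1 / (2 * π) * A + N2 * (Real.log q - Real.log π)) := by
    rw [weilQuadraticChar_eq_neg_prime_add hq χ hκ hg, Complex.add_re, Complex.neg_re, Complex.ofReal_re]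
  have hN2eq : (∫ y : ℝ, ‖g y‖ ^ 2) = N2 := rfl
  -- (P) the prime side
  have hgc : Continuous g := hg.1.continuous
  have hkc : Continuous k := (hg.weilConv hg.weilReflect).1.continuous
  have hks : tsupport k ⊆ Icc (-(2 * t)) (2 * t) := tsupport_weilConv_weilReflect_subset hg.2 hsupp
  have hP : (weilPrimeTermChar χ k).re ≤
      ∑ n ∈ Finset.range (N + 1), (Λ n : ℝ) / Real.sqrt n * (2 * ∫ y : ℝ, ‖g y‖ * ‖g (y - Real.log n)‖) := by
    refine (Complex.re_le_norm _).trans ?_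
    rw [weilPrimeTermChar_eq_sum_of_tsupport_subset χ hkc hN hks]
    refine (norm_sum_le _ _).trans (Finset.sum_le_sum fun n _ ↦ ?_)
    have hΛ : 0 ≤ (Λ n : ℝ) / Real.sqrt n :=
      div_nonneg ArithmeticFunction.vonMangoldt_nonneg (Real.sqrt_nonneg _)
    have hcoef : ‖((Λ n : ℝ) : ℂ) / (Real.sqrt n : ℂ)‖ = (Λ n : ℝ) / Real.sqrt n := by
      rw [← Complex.ofReal_div, Complex.norm_real, Real.norm_of_nonneg hΛ]
    have hχ : ‖χ (n : ZMod q)‖ ≤ 1 := DirichletCharacter.norm_le_one χ _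
    have hneg : ‖k (-Real.log n)‖ = ‖k (Real.log n)‖ := by
      rw [hk, weilConv_weilReflect_neg, Complex.norm_conj]
    have hkL : ‖k (Real.log n)‖ ≤ ∫ y : ℝ, ‖g y‖ * ‖g (y - Real.log n)‖ :=
      norm_weilConv_weilReflect_le_integral_mul g _
    rw [norm_mul, hcoef]
    refine mul_le_mul_of_nonneg_left ?_ hΛ
    refine (norm_add_le _ _).trans ?_
    rw [norm_mul, norm_mul, Complex.norm_conj, hneg]
    have hk0 : 0 ≤ ‖k (Real.log n)‖ := norm_nonneg _
    nlinarith [mul_le_mul_of_nonneg_right hχ hk0]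
  -- (A) the archimedean side with `M` layers
  have hpt : ∀ τ : ℝ, W τ * ((digamma (x : ℂ)).re) + ∑ m ∈ Finset.range M,
      W τ * (1 / ((m : ℝ) + x) - ((m : ℝ) + x) / (((m : ℝ) + x) ^ 2 + (τ / 2) ^ 2)) ≤
      W τ * (digamma ((x : ℂ) + ((τ / 2 : ℝ) : ℂ) * I)).re := by
    intro τ
    have h := re_digamma_ge_sum x hx0 M τ
    have hW0 : 0 ≤ W τ := by positivity
    rw [← Finset.mul_sum, ← mul_add]
    exact mul_le_mul_of_nonneg_left h hW0
  have hIW : Integrable W := integrable_norm_sq_weilMellin_half_line hg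
  have hIψ : Integrable fun τ : ℝ ↦ W τ * (digamma ((x : ℂ) + ((τ / 2 : ℝ) : ℂ) * I)).re := by
    refine (integrable_norm_sq_weilMellin_mul_re_digamma hg hx0).congr (Eventually.of_forall fun τ ↦ ?_)
    simp only [hW]
    congr 3
    push_cast
    ring
  have hIm : ∀ m : ℕ, Integrable fun τ : ℝ ↦
      W τ * (1 / ((m : ℝ) + x) - ((m : ℝ) + x) / (((m : ℝ) + x) ^ 2 + (τ / 2) ^ 2)) := by
    intro m
    have hl : 0 < (m : ℝ) + x := by positivity
    have h1 : Integrable fun τ : ℝ ↦ W τ * (((m : ℝ) + x) / (((m : ℝ) + x) ^ 2 + (τ / 2) ^ 2)) :=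
      integrable_norm_sq_weilMellin_mul hg (continuous_lorentz hl).measurable (A := 1 / ((m : ℝ) + x)) (B := 0)
        (by positivity) le_rfl fun τ ↦ by
          rw [abs_of_nonneg (lorentz_nonneg hl τ), zero_mul, add_zero]
          exact lorentz_le hl τ
    refine ((hIW.mul_const (1 / ((m : ℝ) + x))).sub h1).congr (Eventually.of_forall fun τ ↦ ?_)
    simp only [Pi.sub_apply]
    ring
  have hint := integral_mono
    (f := fun τ : ℝ ↦ W τ * ((digamma (x : ℂ)).re) + ∑ m ∈ Finset.range M,
      W τ * (1 / ((m : ℝ) + x) - ((m : ℝ) + x) / (((m : ℝ) + x) ^ 2 + (τ / 2) ^ 2)))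
    ((hIW.mul_const _).add (integrable_finsetSum _ fun m _ ↦ hIm m)) hIψ hpt
  rw [integral_add (hIW.mul_const _) (integrable_finsetSum _ fun m _ ↦ hIm m), integral_mul_const,
    integral_finsetSum _ (fun m _ ↦ hIm m), integral_norm_sq_weilMellin_half_line hg] at hint
  -- each layer in position space, dominated by the `|g|`-layer
  have hlayer : ∀ m ∈ Finset.range M,
      2 * π * ∫ u : ℝ, Real.exp (-(2 * ((m : ℝ) + x) * |u|)) * (N2 - ∫ y : ℝ, ‖g y‖ * ‖g (y - u)‖) ≤
        ∫ τ : ℝ, W τ * (1 / ((m : ℝ) + x) - ((m : ℝ) + x) / (((m : ℝ) + x) ^ 2 + (τ / 2) ^ 2)) := by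
    intro m _
    have hl : 0 < (m : ℝ) + x := by positivity
    have h1 := layer_eq_integral hg hl
    have h2 := layer_ge_abs hg hl
    have hπ : 0 < 2 * π := by positivity
    rw [← hN2, ← hk] at h1 h2
    have e : ∫ τ : ℝ, W τ * (1 / ((m : ℝ) + x) - ((m : ℝ) + x) / (((m : ℝ) + x) ^ 2 + (τ / 2) ^ 2)) =
        2 * π * ∫ u : ℝ, Real.exp (-(2 * ((m : ℝ) + x) * |u|)) * (N2 - (k u).re) := by
      rw [← h1, ← mul_assoc, mul_one_div_cancel (ne_of_gt hπ), one_mul]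
    rw [e]
    exact mul_le_mul_of_nonneg_left h2 hπ.le
  have hsumlayer := Finset.sum_le_sum hlayer
  rw [← Finset.mul_sum] at hsumlayer
  -- assemble
  have hπ : 0 < 2 * π := by positivity
  have hAge : ((digamma (x : ℂ)).re) * N2 + ∑ m ∈ Finset.range M,
      ∫ u : ℝ, Real.exp (-(2 * ((m : ℝ) + x) * |u|)) * (N2 - ∫ y : ℝ, ‖g y‖ * ‖g (y - u)‖) ≤ 1 / (2 * π) * A := by
    rw [show 1 / (2 * π) * A = A / (2 * π) by ring, le_div_iff₀ hπ]
    have : (2 * π * N2) * (digamma (x : ℂ)).re + 2 * π * ∑ m ∈ Finset.range M,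
        ∫ u : ℝ, Real.exp (-(2 * ((m : ℝ) + x) * |u|)) * (N2 - ∫ y : ℝ, ‖g y‖ * ‖g (y - u)‖) ≤ A :=
      le_trans (by linarith) hint
    linarith
  simp only [trivialKeyFormTrunc]
  rw [hN2eq, hre]
  linarith [hAge, hP]

/-- **FROM ONE PSEUDO-KEY TO EVERY CHARACTER.**  If the all-trivial-key form of parity `κ`, conductor parameter `Q₀`
and `M` layers is non-negative at `|g|` for every test function `g` supported in `[-t, t]`, then
`WeilPositivityOnChar χ t` for EVERY Dirichlet character `χ` of parity `κ` and EVERY modulus `q ≥ Q₀`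
(`T_M` at conductor `q` exceeds `T_M` at `Q₀` by `(log q − log Q₀)‖g‖₂² ≥ 0`).
[cite: Weil1952FormulesExplicites, (11) and the «lemme» p. 262] -/
theorem weilPositivityOnChar_of_trivialKeyFormTrunc_nonneg {q : ℕ} (hq : q ≠ 1) (χ : DirichletCharacter ℂ q)
    {κ : ℕ} (hκ : charParity χ = κ) {t : ℝ} {N : ℕ} (hN : Real.exp (2 * t) ≤ (N : ℝ) + 1) (M : ℕ)
    {Q₀ : ℕ} (hQ₀ : 0 < Q₀) (hQ : Q₀ ≤ q)
    (hpos : ∀ g : ℝ → ℂ, IsWeilTest g → tsupport g ⊆ Icc (-t) t →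
      0 ≤ trivialKeyFormTrunc (1 / 4 + (κ : ℝ) / 2) Q₀ N M (fun y ↦ ‖g y‖)) :
    WeilPositivityOnChar χ t := by
  intro g hg hsupp
  have h1 := re_weilQuadraticChar_ge_trivialKeyFormTrunc hq χ hκ hg hsupp hN M
  have h2 := hpos g hg hsupp
  have hlog : Real.log Q₀ ≤ Real.log q :=
    Real.log_le_log (by exact_mod_cast hQ₀) (by exact_mod_cast hQ)
  have hN20 : 0 ≤ ∫ y : ℝ, ‖g y‖ ^ 2 := integral_nonneg fun _ ↦ by positivity
  have e : trivialKeyFormTrunc (1 / 4 + (κ : ℝ) / 2) q N M (fun y ↦ ‖g y‖) =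
      trivialKeyFormTrunc (1 / 4 + (κ : ℝ) / 2) Q₀ N M (fun y ↦ ‖g y‖) +
        (Real.log q - Real.log Q₀) * ∫ y : ℝ, ‖g y‖ ^ 2 := by
    unfold trivialKeyFormTrunc; ring
  rw [e] at h1
  nlinarith [mul_nonneg (sub_nonneg.2 hlog) hN20]

end UniformFloor

end Summit.Ventures.WeilGRH

end
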